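/-
Copyright (c) 2026. All rights reserved.
Released under Apache 2.0 license as described in the file LICENSE.
-/
import Literature.NumberTheory.Weil1964.ArchDualPairThetaMajorants
import Literature.NumberTheory.Weil1964.AdelicCompactFamilyDominated
import HarnessLib

/-!
# Weil's theta majorants and Lemme 5 for the SECOND factor `1 × U(W)` of the unitary dual pair — no condition on `V`

[Weil1964] A. Weil, *Sur certains groupes d'opérateurs unitaires*, Acta Math. 111 (1964) 143–211, Chap. III n° 41,
Lemme 5 p. 194 («`Ω` compacte dans `Mp(X)_A`, `Φ ∈ 𝒮(X_A)` ⇒ `|SΦ(x)| ≤ Φ₀(x)`, `S ∈ Ω`») and Théorème 6 (1)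
p. 193.  The sibling file `ArchDualPairThetaMajorants` delivers `HasThetaMajorants` for the PAIR family
`(u₁, u₂) ↦ ω_ψ(s_pair(u₁, u₂))` of [GelbartRogawski1991] §3.1 from ONE Levi-form `KAK` input per real place for
Konno–Konno's real pair `U(P_v,Q_v) × U(R_v,S_v)` — and the tree's kinds (`LeviKAKInput.junction` ∕ `.junctionSwap` ∕
`.junctionCompact`) need ONE FACTOR COMPACT at every real place, so a place of type `U(N−1,1) × U(1,1)` (the
doubled pair `(U(V), U(W ⊕ W⁻))` of the Siegel–Weil ∕ Rallis engine at the indefinite place of `V`) is not covered.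

This file treats the RESTRICTION TO THE SECOND FACTOR, `u ↦ ω_ψ(s_pair(1, u))` on `U(J_W)(𝔸_F)`, which is all
that Weil's boundedness argument [Weil1965, Chap. V n° 47 Lemme 20, n° 50] consumes (a dominating `Φ₀` for
`{ω(s(1 ⊗ c))Φ : c ∈ C}`, `C ⊆ U(W)(𝔸)` compact).  For the second factor alone NO condition on `V` is needed:
the bundled interface `LeviKAKInput γ κ a` of `ArchLeviKAKInput` is generic in the acting monoid, and in
`LeviKAKInput.junctionSwap` the first-factor-compact hypothesis enters only the surjectivity of the PAIR's word map;
for `G := U(R,S)` alone acting by `u ↦ ι𝕎(1, u)` the word map is the single group's `kakMap`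
(`RealUnitaryRankOneKAK.isProperMap_kakMap` ∕ `kakMap_surjective`, `|S| = 1`), while frame, dilations and the Levi
identity are those of `JunctionVacuumSectionSwap` verbatim (`frameW`, `planeDilW`, `ι𝕎_one_hypV_eq_conj_leviPhase`)
and the compact part is `dualPairι (1, k)` (`ι𝕎_κ_apply`).

* §0 `nonempty_leviKAKInput_inr` (`|S| = 1`, ANY `P, Q`), `nonempty_leviKAKInput_inr_compact`
  (`U(R) × U(S) → U(R,S)` onto), `nonempty_anyLeviKAKInput_inr` (`|S| ≤ 1` or `R` empty),
  `nonempty_anyLeviKAKInput_inr_of_signs` (sign-frame form) — stated as `Nonempty` THEOREMS (no new definition);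
* §1 for the diagonal unitary dual pair over a quadratic `E/F`, `F` totally real, ANY continuous compatible
  splitting `s` and one second-factor input per real place: `hasThetaMajorants_omega_pairSplitting_inr`
  (`u ↦ ω_ψ(s_pair(1, u))` `HasThetaMajorants`) and **`exists_piSchwartzBruhat_dominating_omega_pairSplitting_inr`**
  (Lemme 5 pointwise: on every compact `C ⊆ U(J_W)(𝔸_F)`, `‖(ω(s_pair(1,u))Φ)(x)‖ ≤ (Φ₀ x).re` for ONE real
  non-negative `Φ₀ ∈ 𝒮(𝔸_Fⁿ)`) — the dictionary is ★ `archPhaseMap_toSp_pair` at `(1, u)`, the engine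
  ★ `hasThetaMajorants_omega_comp_of_kakData` ∕ ★ `exists_piSchwartzBruhat_dominating_omega_comp_of_kakData`
  (whose comparison map `ϖ : H → G` need not be onto, so `H := U(J_W)(𝔸_F)` alone is admissible);
* the consumer's forms (sign frames chosen inside, one sign fact on `t_W` per real place; the CM pin; the hermitian
  PLANE `M = 2` with no sign hypothesis at all) are in the sequel `ArchDualPairThetaMajorantsInrSigns`.

Cell hodgecm-mathlib FLOOR 0, engine E-2 (crux item H413), input (DOM-C) of the `SW2c-BOUND` assembly on Weil's
Lemme 20.  HC_CM is proved only modulo the printed citations until rung 0 closes; nothing here is about Hodge classes.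
Everything is proved; no definition, no cited statement enters as a hypothesis.

## References

* [Weil1964] A. Weil, Acta Math. 111 (1964), Chap. III n° 41, Lemme 5 p. 194, Théorème 6 (1) p. 193.
* [Weil1965] A. Weil, *Sur la formule de Siegel dans la théorie des groupes classiques*, Acta Math. 113 (1965) 1–87,
  Chap. V n° 47 Lemme 20, n° 50.
* [GelbartRogawski1991] S. Gelbart, J. Rogawski, Invent. Math. 105 (1991), §3.1 Prop. 3.1.1 p. 455.
* [KonnoKonno2007] K. Konno, T. Konno, Kyushu J. Math. 61 (2007), §3.1 (3.1).
* [MoeglinVignerasWaldspurger1987] C. Mœglin, M.-F. Vignéras, J.-L. Waldspurger, LNM 1291 (1987), Ch. 1 I.17.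
* [Folland1989] G. B. Folland, *Harmonic Analysis in Phase Space* (1989), §4.2 (4.24) p. 156, Prop. (4.39).
* [Knapp2002] A. W. Knapp, *Lie Groups Beyond an Introduction*, 2nd ed. (2002), Thm 7.39.
-/

noncomputable section

open scoped Matrix Real Classical ComplexConjugate
open Complex NumberField NumberField.InfinitePlace NumberField.mixedEmbedding IsDedekindDomain
open Literature.NumberTheory.Automorphic Literature.NumberTheory.Automorphic.UnitaryGroup
open Literature.RepresentationTheory.HeisenbergGroup Literature.Analysis.SegalBargmann
open Literature.RepresentationTheory.KonnoKonno2007 Literature.RepresentationTheory.KonnoKonno2007.RealDualPair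

namespace Literature.NumberTheory.Weil1964

/-! ## §0 The second-factor action `u ↦ ι𝕎(1, u)` of `U(R,S)` has a Levi-form `KAK` input for ANY `P, Q` -/

section SecondFactor

variable (P Q : Type) {R S : Type} [Fintype P] [DecidableEq P] [Fintype Q] [DecidableEq Q] [Fintype R]
  [DecidableEq R] [Fintype S] [DecidableEq S]

/-- `(1, u·u') = (1, u)·(1, u')` in `G_∞ = U(P,Q) × U(R,S)`. [folklore] -/
private theorem one_prod_mul (u u' : UForm R S) :
    (((1 : UForm P Q), u * u') : Ginf P Q R S) = ((1 : UForm P Q), u) * ((1 : UForm P Q), u') := by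
  rw [Prod.mk_mul_mk, mul_one]

/-- `κ (1, k) = (1, kV k)`. [folklore] -/
private theorem κ_one_left (k : Matrix.unitaryGroup R ℂ × Matrix.unitaryGroup S ℂ) :
    κ P Q R S ((1 : Matrix.unitaryGroup P ℂ × Matrix.unitaryGroup Q ℂ), k) = ((1 : UForm P Q), UForm.kV R S k) :=
  Prod.ext (map_one (UForm.kV P Q)) rfl

/-- **Second factor of real rank one (`|S| = 1`), ANY first factor**: the action `u ↦ ι𝕎(1, u)` of `U(R,S)` on the
phase space of `V ⊗ W` has a Levi-form `KAK` input with compact generators `U(R) × U(S)` (matrices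
`dualPairι (1, k)`), `A`-part `a'_t = hypV r₀ s₀ t` in the frame `frameW` with dilations `planeDilW`
(`ι𝕎_one_hypV_eq_conj_leviPhase`), and word map the single group's `kakMap r₀ s₀` (proper and onto).
[cite: KonnoKonno2007, §3.1 (3.1); MoeglinVignerasWaldspurger1987, Ch. 1 I.17; Folland1989, §4.2 (4.24) p. 156,
Prop. (4.39); Knapp2002, Thm 7.39] -/
theorem nonempty_leviKAKInput_inr (r₀ : R) (s₀ : S) [Subsingleton S] :
    Nonempty (LeviKAKInput
      (fun u : UForm R S => (⇑((ι𝕎 P Q R S ((1 : UForm P Q), u)).1 :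
        ((DPIdx P Q R S → ℝ) × (DPIdx P Q R S → ℝ)) ≃ₗ[ℝ] ((DPIdx P Q R S → ℝ) × (DPIdx P Q R S → ℝ))) :
        PhaseMap (DPIdx P Q R S)))
      (UForm.kV R S) (fun t : ℝ => (hypV r₀ s₀ t : UForm R S))) :=
  ⟨{ map_mul := fun u u' pq => by
       show ((ι𝕎 P Q R S ((1 : UForm P Q), u * u')).1 :
           ((DPIdx P Q R S → ℝ) × (DPIdx P Q R S → ℝ)) ≃ₗ[ℝ] ((DPIdx P Q R S → ℝ) × (DPIdx P Q R S → ℝ))) pq = _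
       rw [one_prod_mul P Q u u']
       exact symplecticPhaseMap_mul (ι𝕎 P Q R S) _ _ pq
     ιK := fun k => dualPairι ((1 : Matrix.unitaryGroup P ℂ × Matrix.unitaryGroup Q ℂ), k)
     continuous_ιK := continuous_dualPairι.comp (continuous_const.prodMk continuous_id)
     hreal := fun k pq => by
       show ((ι𝕎 P Q R S ((1 : UForm P Q), UForm.kV R S k)).1 :
           ((DPIdx P Q R S → ℝ) × (DPIdx P Q R S → ℝ)) ≃ₗ[ℝ] ((DPIdx P Q R S → ℝ) × (DPIdx P Q R S → ℝ))) pq = _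
       rw [← κ_one_left P Q k]
       exact ι𝕎_κ_apply R S _ pq
     U := frameW P Q r₀ s₀
     L := fun t => planeDilW P Q r₀ s₀ t
     Ld := fun t => (planeDilW P Q r₀ s₀ t).symm
     had := fun t x y => by
       rw [planeDilW, reindexLin_symm]
       exact reindexLin_dotProduct (swapIdx P Q R S)
         (planeDil_dotProduct_symm P Q r₀ s₀ (Real.exp t) (Real.exp_pos t).ne') x y
     hL := continuous_reindexLin_symm (swapIdx P Q R S) (continuous_planeDil_exp_symm P Q r₀ s₀)
     hγA := ι𝕎_one_hypV_eq_conj_leviPhase P Q r₀ s₀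
     isProperMap_word := isProperMap_kakMap r₀ s₀
     word_surjective := kakMap_surjective r₀ s₀ }⟩

/-- **Second factor compact** (`U(R) × U(S) → U(R,S)` onto — e.g. `R` or `S` empty), ANY first factor: trivial
`A`-part (`LeviKAKInput.ofCompact`). [cite: Folland1989, §4.2, Prop. (4.39); KonnoKonno2007, §3.1 (3.1)] -/
theorem nonempty_leviKAKInput_inr_compact (hW : Function.Surjective (UForm.kV R S)) :
    Nonempty (LeviKAKInput
      (fun u : UForm R S => (⇑((ι𝕎 P Q R S ((1 : UForm P Q), u)).1 :
        ((DPIdx P Q R S → ℝ) × (DPIdx P Q R S → ℝ)) ≃ₗ[ℝ] ((DPIdx P Q R S → ℝ) × (DPIdx P Q R S → ℝ))) :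
        PhaseMap (DPIdx P Q R S)))
      (UForm.kV R S) (fun _ : PUnit => (1 : UForm R S))) :=
  haveI := compactSpace_matrixUnitaryGroup R
  haveI := compactSpace_matrixUnitaryGroup S
  ⟨LeviKAKInput.ofCompact
    (fun u u' pq => by
      show ((ι𝕎 P Q R S ((1 : UForm P Q), u * u')).1 :
          ((DPIdx P Q R S → ℝ) × (DPIdx P Q R S → ℝ)) ≃ₗ[ℝ] ((DPIdx P Q R S → ℝ) × (DPIdx P Q R S → ℝ))) pq = _
      rw [one_prod_mul P Q u u']
      exact symplecticPhaseMap_mul (ι𝕎 P Q R S) _ _ pq)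
    (fun pq => ι𝕎_one_apply pq) UForm.continuous_kV
    (fun k => dualPairι ((1 : Matrix.unitaryGroup P ℂ × Matrix.unitaryGroup Q ℂ), k))
    (continuous_dualPairι.comp (continuous_const.prodMk continuous_id))
    (fun k pq => by
      show ((ι𝕎 P Q R S ((1 : UForm P Q), UForm.kV R S k)).1 :
          ((DPIdx P Q R S → ℝ) × (DPIdx P Q R S → ℝ)) ≃ₗ[ℝ] ((DPIdx P Q R S → ℝ) × (DPIdx P Q R S → ℝ))) pq = _
      rw [← κ_one_left P Q k]
      exact ι𝕎_κ_apply R S _ pq)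
    fun u => by
      obtain ⟨k, hk⟩ := hW u
      exact ⟨k, 1, by rw [map_one, mul_one]; exact hk⟩⟩

/-- **Rank profile of the second factor alone: `U(R,S)` of real rank `≤ 1` (`|S| ≤ 1`) or compact with `R` empty —
for EVERY signature of the first factor** (`nonempty_leviKAKInput_inr` ∕ `_compact`, kind-erased).
[cite: KonnoKonno2007, §3.1 (3.1); MoeglinVignerasWaldspurger1987, Ch. 1 I.17; Folland1989, §4.2 (4.24) p. 156,
Prop. (4.39); Knapp2002, Thm 7.39] -/
theorem nonempty_anyLeviKAKInput_inr (hS : Fintype.card S ≤ 1 ∨ IsEmpty R) :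
    Nonempty (AnyLeviKAKInput
      (fun u : UForm R S => (⇑((ι𝕎 P Q R S ((1 : UForm P Q), u)).1 :
        ((DPIdx P Q R S → ℝ) × (DPIdx P Q R S → ℝ)) ≃ₗ[ℝ] ((DPIdx P Q R S → ℝ) × (DPIdx P Q R S → ℝ))) :
        PhaseMap (DPIdx P Q R S)))) := by
  rcases hS with hS | _
  · haveI : Subsingleton S := Fintype.card_le_one_iff_subsingleton.mp hS
    rcases isEmpty_or_nonempty S with _ | ⟨⟨s₀⟩⟩
    · obtain ⟨I⟩ := nonempty_leviKAKInput_inr_compact P Q (R := R) (S := S) UForm.kV_surjective_of_isEmpty_right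
      exact ⟨⟨_, PUnit, UForm.kV R S, _, I⟩⟩
    · rcases isEmpty_or_nonempty R with _ | ⟨⟨r₀⟩⟩
      · obtain ⟨I⟩ := nonempty_leviKAKInput_inr_compact P Q (R := R) (S := S) UForm.kV_surjective_of_isEmpty_left
        exact ⟨⟨_, PUnit, UForm.kV R S, _, I⟩⟩
      · obtain ⟨I⟩ := nonempty_leviKAKInput_inr P Q r₀ s₀
        exact ⟨⟨_, ℝ, UForm.kV R S, _, I⟩⟩
  · obtain ⟨I⟩ := nonempty_leviKAKInput_inr_compact P Q (R := R) (S := S) UForm.kV_surjective_of_isEmpty_left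
    exact ⟨⟨_, PUnit, UForm.kV R S, _, I⟩⟩

end SecondFactor

section SecondFactorSigns

variable {N M : ℕ}

/-- **Rank profile of the second factor in canonical sign frames**: `y` with at most one non-positive entry, or
everywhere negative; `x` ARBITRARY. [cite: KonnoKonno2007, §3.1 (3.1); MoeglinVignerasWaldspurger1987, Ch. 1
I.17; Folland1989, §4.2 (4.24) p. 156, Prop. (4.39); Knapp2002, Thm 7.39] -/
theorem nonempty_anyLeviKAKInput_inr_of_signs (x : Fin N → ℝ) {y : Fin M → ℝ}
    (hy : (∃ j₀, ∀ j, j ≠ j₀ → 0 < y j) ∨ ∀ j, y j < 0) :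
    Nonempty (AnyLeviKAKInput
      (fun u : UForm (PosIdx y) (NegIdx y) =>
        (⇑((ι𝕎 (PosIdx x) (NegIdx x) (PosIdx y) (NegIdx y) ((1 : UForm (PosIdx x) (NegIdx x)), u)).1 :
          ((DPIdx (PosIdx x) (NegIdx x) (PosIdx y) (NegIdx y) → ℝ) ×
              (DPIdx (PosIdx x) (NegIdx x) (PosIdx y) (NegIdx y) → ℝ)) ≃ₗ[ℝ]
            ((DPIdx (PosIdx x) (NegIdx x) (PosIdx y) (NegIdx y) → ℝ) ×
              (DPIdx (PosIdx x) (NegIdx x) (PosIdx y) (NegIdx y) → ℝ))) :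
          PhaseMap (DPIdx (PosIdx x) (NegIdx x) (PosIdx y) (NegIdx y))))) :=
  nonempty_anyLeviKAKInput_inr (PosIdx x) (NegIdx x)
    (hy.elim (fun ⟨j₀, h⟩ => Or.inl (card_negIdx_le_one j₀ h)) fun h => Or.inr (isEmpty_posIdx h))

end SecondFactorSigns

/-! ## §1 The second-factor family `u ↦ ω_ψ(s_pair(1, u))` of a diagonal unitary dual pair over `E/F` -/

section Pair

variable {F : Type} [Field F] [NumberField F] (E : Type) [Field E] [NumberField E] [Algebra F E] (c : E ≃ₐ[F] E)
  (N M : ℕ) {m : ℕ} (e : Fin N × Fin M ≃ Fin m)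
  (tV : Fin N → F) (tW : Fin M → F) {JV : Matrix (Fin N) (Fin N) E} {JW : Matrix (Fin M) (Fin M) E}
  (hJV : JV = (Matrix.diagonal tV).map (algebraMap F E)) (hJW : JW = (Matrix.diagonal tW).map (algebraMap F E))
  {P Q R S : {v : InfinitePlace F // v.IsReal} → Type*} [∀ v, Fintype (P v)] [∀ v, DecidableEq (P v)]
  [∀ v, Fintype (Q v)] [∀ v, DecidableEq (Q v)] [∀ v, Fintype (R v)] [∀ v, DecidableEq (R v)]
  [∀ v, Fintype (S v)] [∀ v, DecidableEq (S v)]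
  [IsTotallyReal F] [Algebra.IsQuadraticExtension F E] {δ : E} (hcδ : c δ = -δ) (hδ : δ ≠ 0) {d : F}
  (hd : δ * δ = algebraMap F E d) (hV : (Matrix.diagonal tV).IsSymm) (hW : (Matrix.diagonal tW).IsSymm)

omit [IsTotallyReal F] [Algebra.IsQuadraticExtension F E] in
/-- the archimedean components of `(1, u)` are `(1, ·)` place by place (`archPairPlace v` is a `prodMap`). [folklore] -/
private theorem archPairPlace_one_left (hc : c ≠ 1)
    (wOf : {v : InfinitePlace F // v.IsReal} → {w : InfinitePlace E // w.IsComplex})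
    (hw : ∀ v, c • (wOf v).1 = (wOf v).1) (hover : ∀ v, (wOf v).1.comap (algebraMap F E) = v.1)
    (εV : ∀ v, Fin N ≃ P v ⊕ Q v) (εW : ∀ v, Fin M ≃ R v ⊕ S v)
    {DV : {v : InfinitePlace F // v.IsReal} → Fin N → ℝ} {DW : {v : InfinitePlace F // v.IsReal} → Fin M → ℝ}
    (hDV0 : ∀ v i, DV v i ≠ 0) (hDW0 : ∀ v j, DW v j ≠ 0) {cV cW : {v : InfinitePlace F // v.IsReal} → ℝ}
    (hcV : ∀ v, cV v ≠ 0) (hcW : ∀ v, cW v ≠ 0)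
    (htV : ∀ v i, embedding_of_isReal v.2 (tV i) = cV v * signOf (εV v i) * DV v i ^ 2)
    (htW : ∀ v j, embedding_of_isReal v.2 (tW j) = cW v * signOf (εW v j) * DW v j ^ 2)
    (v : {v : InfinitePlace F // v.IsReal}) (u : UnitaryGroup.adelic F E c M JW) :
    archPairPlace E c N M hc wOf hw hover tV tW hJV hJW εV εW hDV0 hDW0 hcV hcW htV htW v (1, u) =
      ((1 : UForm (P v) (Q v)),
        (archPairPlace E c N M hc wOf hw hover tV tW hJV hJW εV εW hDV0 hDW0 hcV hcW htV htW v (1, u)).2) := by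
  simp only [archPairPlace, MonoidHom.coe_prodMap, Prod.map_apply, map_one]

/-- **The dictionary at `(1, u)`**: in the scaled Folland frame, the archimedean phase-space action of
`π(s_pair(1, u)) = ι(1 ⊗ u)` is the slice-by-slice phase map of the SECOND-FACTOR actions `u_v ↦ ι𝕎(1, u_v)` at the
archimedean components of `u` (★ `archPhaseMap_toSp_pair`, ★ `proj_pairSplitting`). [cite: GelbartRogawski1991,
§3.1 p. 454–455; KonnoKonno2007, §3.1 (3.1); Folland1989, Ch. 4 §1, Prop. (4.6) p. 151] -/
theorem archPhaseMap_proj_pairSplitting_one_left (hc : c ≠ 1)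
    (wOf : {v : InfinitePlace F // v.IsReal} → {w : InfinitePlace E // w.IsComplex})
    (hw : ∀ v, c • (wOf v).1 = (wOf v).1) (hover : ∀ v, (wOf v).1.comap (algebraMap F E) = v.1)
    (εV : ∀ v, Fin N ≃ P v ⊕ Q v) (εW : ∀ v, Fin M ≃ R v ⊕ S v)
    {DV : {v : InfinitePlace F // v.IsReal} → Fin N → ℝ} {DW : {v : InfinitePlace F // v.IsReal} → Fin M → ℝ}
    (hDV0 : ∀ v i, DV v i ≠ 0) (hDW0 : ∀ v j, DW v j ≠ 0) {cV cW : {v : InfinitePlace F // v.IsReal} → ℝ}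
    (hcV : ∀ v, cV v ≠ 0) (hcW : ∀ v, cW v ≠ 0)
    (htV : ∀ v i, embedding_of_isReal v.2 (tV i) = cV v * signOf (εV v i) * DV v i ^ 2)
    (htW : ∀ v j, embedding_of_isReal v.2 (tW j) = cW v * signOf (εW v j) * DW v j ^ 2)
    (hcc : ∀ v, cV v * cW v = ((wOf v).1.embedding δ).im)
    (hVd : IsUnit (Matrix.diagonal tV).det) (hWd : IsUnit (Matrix.diagonal tW).det)
    {s : UnitaryGroup.adelicPair F E c N M JV JW →* adelicMpCont F (Fin m)
      (GelbartRogawski1991.UnitaryDualPair.adelicGram F e (Matrix.diagonal tV) (Matrix.diagonal tW))}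
    (hs : (GelbartRogawski1991.UnitaryDualPair.splittingDatum F E c N M e JV JW hcδ hδ hd hV hW hVd hWd hJV
      hJW).IsCompatible s)
    (u : UnitaryGroup.adelic F E c M JW) :
    archPhaseMap (GelbartRogawski1991.UnitaryDualPair.adelicGram F e (Matrix.diagonal tV) (Matrix.diagonal tW))
        (scaledFrame F (Fin m) (pairScale N M (e := e) DV DW) (pairScale_ne_zero N M hDV0 hDW0))
        (isUnit_archMat_of_isUnit _ (GelbartRogawski1991.UnitaryDualPair.isUnit_adelicGram F e hVd hWd))
        (adelicMpCont.proj F (Fin m) _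
          (GelbartRogawski1991.UnitaryDualPair.pairSplitting F E c N M e JV JW s (1, u))) =
      placePhase fun v => reindexPhase (pairFrame (P v) (Q v) (R v) (S v) e (εV v) (εW v))
        (⇑((ι𝕎 (P v) (Q v) (R v) (S v) ((1 : UForm (P v) (Q v)),
          (archPairPlace E c N M hc wOf hw hover tV tW hJV hJW εV εW hDV0 hDW0 hcV hcW htV htW v (1, u)).2)).1 :
          ((DPIdx (P v) (Q v) (R v) (S v) → ℝ) × (DPIdx (P v) (Q v) (R v) (S v) → ℝ)) ≃ₗ[ℝ]
            ((DPIdx (P v) (Q v) (R v) (S v) → ℝ) × (DPIdx (P v) (Q v) (R v) (S v) → ℝ)))) := by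
  rw [GelbartRogawski1991.UnitaryDualPair.proj_pairSplitting F E c N M e JV JW hcδ hδ hd hV hW hVd hWd hJV hJW hs
    (1, u), archPhaseMap_toSp_pair E c N M e hc wOf hw hover tV tW hJV hJW εV εW hDV0 hDW0 hcV hcW htV htW hcδ hδ hd
    hV hW hcc _ 1 u]
  congr 1
  funext v
  rw [← archPairPlace_one_left E c N M tV tW hJV hJW hc wOf hw hover εV εW hDV0 hDW0 hcV hcW htV htW v u]

/-- **Weil's theta majorants for the SECOND factor of the unitary dual pair — no condition on `V`.**  For
`J_V = diag(t_V) ⊗ 1`, `J_W = diag(t_W) ⊗ 1`, per-place sign frames and adapted scalings, ONE Levi-form `KAK` input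
per real place for the second-factor action `u_v ↦ ι𝕎(1, u_v)` of `U(R_v,S_v)` (§0: `U(W_v)` of real rank `≤ 1`,
`V_v` arbitrary), and a continuous COMPATIBLE splitting `s` ([GelbartRogawski1991] (3.1.1)–(3.1.2)): the family
`u ↦ ω_ψ(s_pair(1, u))` on `𝒮(𝔸_Fⁿ)`, `u ∈ U(J_W)(𝔸_F)`, `HasThetaMajorants`. [cite: Weil1964, Chap. III n° 41
Lemme 5 p. 194, Théorème 6 (1) p. 193; GelbartRogawski1991, §3.1 Prop. 3.1.1 p. 455; Folland1989, §4.2 (4.24)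
p. 156, Prop. (4.39)] -/
theorem hasThetaMajorants_omega_pairSplitting_inr (hc : c ≠ 1)
    (wOf : {v : InfinitePlace F // v.IsReal} → {w : InfinitePlace E // w.IsComplex})
    (hw : ∀ v, c • (wOf v).1 = (wOf v).1) (hover : ∀ v, (wOf v).1.comap (algebraMap F E) = v.1)
    (εV : ∀ v, Fin N ≃ P v ⊕ Q v) (εW : ∀ v, Fin M ≃ R v ⊕ S v)
    {DV : {v : InfinitePlace F // v.IsReal} → Fin N → ℝ} {DW : {v : InfinitePlace F // v.IsReal} → Fin M → ℝ}
    (hDV0 : ∀ v i, DV v i ≠ 0) (hDW0 : ∀ v j, DW v j ≠ 0) {cV cW : {v : InfinitePlace F // v.IsReal} → ℝ}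
    (hcV : ∀ v, cV v ≠ 0) (hcW : ∀ v, cW v ≠ 0)
    (htV : ∀ v i, embedding_of_isReal v.2 (tV i) = cV v * signOf (εV v i) * DV v i ^ 2)
    (htW : ∀ v j, embedding_of_isReal v.2 (tW j) = cW v * signOf (εW v j) * DW v j ^ 2)
    (hcc : ∀ v, cV v * cW v = ((wOf v).1.embedding δ).im)
    (hVd : IsUnit (Matrix.diagonal tV).det) (hWd : IsUnit (Matrix.diagonal tW).det)
    {Kk Pa : {v : InfinitePlace F // v.IsReal} → Type*} [∀ v, TopologicalSpace (Kk v)]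
    [∀ v, TopologicalSpace (Pa v)] {κf : ∀ v, Kk v → UForm (R v) (S v)} {af : ∀ v, Pa v → UForm (R v) (S v)}
    (I : ∀ v, LeviKAKInput
      (fun u : UForm (R v) (S v) => (⇑((ι𝕎 (P v) (Q v) (R v) (S v) ((1 : UForm (P v) (Q v)), u)).1 :
        ((DPIdx (P v) (Q v) (R v) (S v) → ℝ) × (DPIdx (P v) (Q v) (R v) (S v) → ℝ)) ≃ₗ[ℝ]
          ((DPIdx (P v) (Q v) (R v) (S v) → ℝ) × (DPIdx (P v) (Q v) (R v) (S v) → ℝ))) :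
        PhaseMap (DPIdx (P v) (Q v) (R v) (S v))))
      (κf v) (af v))
    {s : UnitaryGroup.adelicPair F E c N M JV JW →* adelicMpCont F (Fin m)
      (GelbartRogawski1991.UnitaryDualPair.adelicGram F e (Matrix.diagonal tV) (Matrix.diagonal tW))}
    (hs : (GelbartRogawski1991.UnitaryDualPair.splittingDatum F E c N M e JV JW hcδ hδ hd hV hW hVd hWd hJV
      hJW).IsCompatible s)
    (hsc : Continuous s) :
    HasThetaMajorants (F := F) fun (u : UnitaryGroup.adelic F E c M JW) Φ => adelicMpCont.omega F (Fin m)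
      (GelbartRogawski1991.UnitaryDualPair.adelicGram F e (Matrix.diagonal tV) (Matrix.diagonal tW))
      (GelbartRogawski1991.UnitaryDualPair.pairSplitting F E c N M e JV JW s (1, u)) Φ :=
  hasThetaMajorants_omega_comp_of_kakData (GelbartRogawski1991.UnitaryDualPair.isUnit_adelicGram F e hVd hWd)
    ((GelbartRogawski1991.UnitaryDualPair.pairSplitting F E c N M e JV JW s).comp
      (MonoidHom.inr (UnitaryGroup.adelic F E c N JV) (UnitaryGroup.adelic F E c M JW)))
    ((GelbartRogawski1991.UnitaryDualPair.continuous_pairSplitting F E c N M e JV JW hsc).comp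
      (continuous_const.prodMk continuous_id))
    (scaledFrame F (Fin m) (pairScale N M (e := e) DV DW) (pairScale_ne_zero N M hDV0 hDW0))
    (isUnit_archMat_of_isUnit _ (GelbartRogawski1991.UnitaryDualPair.isUnit_adelicGram F e hVd hWd))
    (kakImplementerData_leviFamily_places_reindex (fun v => pairFrame (P v) (Q v) (R v) (S v) e (εV v) (εW v)) I)
    (fun u v => (archPairPlace E c N M hc wOf hw hover tV tW hJV hJW εV εW hDV0 hDW0 hcV hcW htV htW v (1, u)).2)
    (continuous_pi fun v => continuous_snd.comp
      ((continuous_archPairPlace E c N M hc wOf hw hover tV tW hJV hJW εV εW hDV0 hDW0 hcV hcW htV htW v).comp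
        (continuous_const.prodMk continuous_id)))
    fun u => archPhaseMap_proj_pairSplitting_one_left E c N M e tV tW hJV hJW hcδ hδ hd hV hW hc wOf hw hover εV εW
      hDV0 hDW0 hcV hcW htV htW hcc hVd hWd hs u

/-- **Weil's Lemme 5 (pointwise adelic form) for the SECOND factor of the unitary dual pair — no condition on `V`.**
Same data as `hasThetaMajorants_omega_pairSplitting_inr`: for every `Φ ∈ 𝒮(𝔸_Fⁿ)` and every compact
`C ⊆ U(J_W)(𝔸_F)` there is ONE real non-negative `Φ₀ ∈ 𝒮(𝔸_Fⁿ)` with `‖(ω_ψ(s_pair(1, u))Φ)(x)‖ ≤ (Φ₀ x).re` for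
all `u ∈ C` and `x ∈ 𝔸_Fⁿ` (★ `exists_piSchwartzBruhat_dominating_omega_comp_of_kakData`). [cite: Weil1964, Chap. III
n° 41, Lemme 5 p. 194; Weil1965, Chap. V n° 47, n° 50; GelbartRogawski1991, §3.1 Prop. 3.1.1 p. 455; Folland1989,
§4.2 (4.24) p. 156, Prop. (4.39)] -/
theorem exists_piSchwartzBruhat_dominating_omega_pairSplitting_inr (hc : c ≠ 1)
    (wOf : {v : InfinitePlace F // v.IsReal} → {w : InfinitePlace E // w.IsComplex})
    (hw : ∀ v, c • (wOf v).1 = (wOf v).1) (hover : ∀ v, (wOf v).1.comap (algebraMap F E) = v.1)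
    (εV : ∀ v, Fin N ≃ P v ⊕ Q v) (εW : ∀ v, Fin M ≃ R v ⊕ S v)
    {DV : {v : InfinitePlace F // v.IsReal} → Fin N → ℝ} {DW : {v : InfinitePlace F // v.IsReal} → Fin M → ℝ}
    (hDV0 : ∀ v i, DV v i ≠ 0) (hDW0 : ∀ v j, DW v j ≠ 0) {cV cW : {v : InfinitePlace F // v.IsReal} → ℝ}
    (hcV : ∀ v, cV v ≠ 0) (hcW : ∀ v, cW v ≠ 0)
    (htV : ∀ v i, embedding_of_isReal v.2 (tV i) = cV v * signOf (εV v i) * DV v i ^ 2)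
    (htW : ∀ v j, embedding_of_isReal v.2 (tW j) = cW v * signOf (εW v j) * DW v j ^ 2)
    (hcc : ∀ v, cV v * cW v = ((wOf v).1.embedding δ).im)
    (hVd : IsUnit (Matrix.diagonal tV).det) (hWd : IsUnit (Matrix.diagonal tW).det)
    {Kk Pa : {v : InfinitePlace F // v.IsReal} → Type*} [∀ v, TopologicalSpace (Kk v)]
    [∀ v, TopologicalSpace (Pa v)] {κf : ∀ v, Kk v → UForm (R v) (S v)} {af : ∀ v, Pa v → UForm (R v) (S v)}
    (I : ∀ v, LeviKAKInput
      (fun u : UForm (R v) (S v) => (⇑((ι𝕎 (P v) (Q v) (R v) (S v) ((1 : UForm (P v) (Q v)), u)).1 :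
        ((DPIdx (P v) (Q v) (R v) (S v) → ℝ) × (DPIdx (P v) (Q v) (R v) (S v) → ℝ)) ≃ₗ[ℝ]
          ((DPIdx (P v) (Q v) (R v) (S v) → ℝ) × (DPIdx (P v) (Q v) (R v) (S v) → ℝ))) :
        PhaseMap (DPIdx (P v) (Q v) (R v) (S v))))
      (κf v) (af v))
    {s : UnitaryGroup.adelicPair F E c N M JV JW →* adelicMpCont F (Fin m)
      (GelbartRogawski1991.UnitaryDualPair.adelicGram F e (Matrix.diagonal tV) (Matrix.diagonal tW))}
    (hs : (GelbartRogawski1991.UnitaryDualPair.splittingDatum F E c N M e JV JW hcδ hδ hd hV hW hVd hWd hJV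
      hJW).IsCompatible s)
    (hsc : Continuous s) (Φ : piSchwartzBruhat F (Fin m)) {C : Set (UnitaryGroup.adelic F E c M JW)}
    (hC : IsCompact C) :
    ∃ Φ₀ : (Fin m → AdeleRing (𝓞 F) F) → ℂ, Φ₀ ∈ piSchwartzBruhat F (Fin m) ∧
      (∀ x, (Φ₀ x).im = 0 ∧ 0 ≤ (Φ₀ x).re) ∧
        ∀ u ∈ C, ∀ x, ‖((adelicMpCont.omega F (Fin m)
          (GelbartRogawski1991.UnitaryDualPair.adelicGram F e (Matrix.diagonal tV) (Matrix.diagonal tW))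
          (GelbartRogawski1991.UnitaryDualPair.pairSplitting F E c N M e JV JW s (1, u)) Φ :
            piSchwartzBruhat F (Fin m)) : (Fin m → AdeleRing (𝓞 F) F) → ℂ) x‖ ≤ (Φ₀ x).re :=
  exists_piSchwartzBruhat_dominating_omega_comp_of_kakData
    (GelbartRogawski1991.UnitaryDualPair.isUnit_adelicGram F e hVd hWd)
    ((GelbartRogawski1991.UnitaryDualPair.pairSplitting F E c N M e JV JW s).comp
      (MonoidHom.inr (UnitaryGroup.adelic F E c N JV) (UnitaryGroup.adelic F E c M JW)))
    ((GelbartRogawski1991.UnitaryDualPair.continuous_pairSplitting F E c N M e JV JW hsc).comp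
      (continuous_const.prodMk continuous_id))
    (scaledFrame F (Fin m) (pairScale N M (e := e) DV DW) (pairScale_ne_zero N M hDV0 hDW0))
    (isUnit_archMat_of_isUnit _ (GelbartRogawski1991.UnitaryDualPair.isUnit_adelicGram F e hVd hWd))
    (kakImplementerData_leviFamily_places_reindex (fun v => pairFrame (P v) (Q v) (R v) (S v) e (εV v) (εW v)) I)
    (fun u v => (archPairPlace E c N M hc wOf hw hover tV tW hJV hJW εV εW hDV0 hDW0 hcV hcW htV htW v (1, u)).2)
    (continuous_pi fun v => continuous_snd.comp
      ((continuous_archPairPlace E c N M hc wOf hw hover tV tW hJV hJW εV εW hDV0 hDW0 hcV hcW htV htW v).comp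
        (continuous_const.prodMk continuous_id)))
    (fun u => archPhaseMap_proj_pairSplitting_one_left E c N M e tV tW hJV hJW hcδ hδ hd hV hW hc wOf hw hover εV
      εW hDV0 hDW0 hcV hcW htV htW hcc hVd hWd hs u)
    Φ hC

end Pair

end Literature.NumberTheory.Weil1964

end
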